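import Mathlib
import HarnessLib
import Summits.ValiantsHypothesis.ValiantsHypothesis.Theorems.LacunarySymmetroidMatrixDescartesProductPlusOneSixthOrderShell
import Summits.ValiantsHypothesis.ValiantsHypothesis.Theorems.LacunarySymmetroidMatrixDescartesProductPlusOneEighthOrderShell

/-!
# LINE (A) `product_plus_one` (crux `MatrixDescartes`, stmt-ValiantsHypothesis-18050, V1) — W-CB, brick C1: THE DEFECT SHELLS (SHELL-σ)

Pen val-idea-25 g6 memo §30.5, item C1.  The Rolle shells of record (✓ E2a `no_seven_zeros_of_sixth_order_law`, ✓ E4♯b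
`no_nine_zeros_of_eighth_order_law`) take the law `L S ≠ 0` POINTWISE on the window (zero defects).  Inside a knee's ring the law does vanish; what the
accounting (§30) consumes is the DEFECT form: if the law `L S` has no strictly increasing chain of `z+1` zeros in the window (at most `z` «defects»), then
`S₀` has no chain of `ord(L) + 1 + z` zeros there — ★ `no_chain_of_sixth_order_law_defects` (`z+7`), ★ `no_chain_of_eighth_order_law_defects` (`z+9`).
Proofs = the accepted towers verbatim with the chain lengths shifted by `z` (✓ `theta_sq_chain` / ✓ `theta_sq_chain_real` with `m := z+4, z+2, z`,
resp. `z+6, z+4, z+2, z`).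

HONEST FRAMING: pure real analysis; proves nothing about `WronskianBudgetK3` / `OneChangeFloorK3` / the stubs / 18050 / `MatrixDescartes` / B by itself;
`VP ≠ VNP` is NOT proved.  No definitions, no named facts, no sorry; Mathlib + ✓ lane shells only.
-/

set_option linter.dupNamespace false

namespace Summit.ValiantsHypothesis.ValiantsHypothesis.Theorems.LacunarySymmetroidMatrixDescartes

namespace ProductPlusOne

open Finset Set
open scoped BigOperators Topology

/-- ★ **SHELL-σ (order six, lattice rates)**: if the order-6 law `L₃S = S₆ − (λ₁²+λ₂²+λ₃²)S₄ + (…)S₂ − λ₁²λ₂²λ₃²S₀` (λᵢ = kᵢ+1) has NO strictly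
increasing chain of `z+1` zeros in the window, then `S₀` has no strictly increasing chain of `z+7` zeros there (`z = 0` is ✓ `no_seven_zeros_of_sixth_order_law`).
Same Rolle tower (✓ `theta_sq_chain` thrice, with `m := z+4, z+2, z`). [this file's theorem] -/
theorem no_chain_of_sixth_order_law_defects (k₁ k₂ k₃ : ℕ) (z : ℕ) {S₀ S₁ S₂ S₃ S₄ S₅ S₆ : ℝ → ℝ} {u v : ℝ} (hu : 0 ≤ u)
    (h0 : ∀ x ∈ Ioo u v, HasDerivAt S₀ (S₁ x / x) x) (h1 : ∀ x ∈ Ioo u v, HasDerivAt S₁ (S₂ x / x) x)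
    (h2 : ∀ x ∈ Ioo u v, HasDerivAt S₂ (S₃ x / x) x) (h3 : ∀ x ∈ Ioo u v, HasDerivAt S₃ (S₄ x / x) x)
    (h4 : ∀ x ∈ Ioo u v, HasDerivAt S₄ (S₅ x / x) x) (h5 : ∀ x ∈ Ioo u v, HasDerivAt S₅ (S₆ x / x) x)
    (hlaw : ∀ w : Fin (z + 1) → ℝ, StrictMono w → (∀ i, w i ∈ Ioo u v) →
      ¬ (∀ i,
      S₆ (w i) - (((k₁ : ℝ) + 1) ^ 2 + ((k₂ : ℝ) + 1) ^ 2 + ((k₃ : ℝ) + 1) ^ 2) * S₄ (w i)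
        + (((k₁ : ℝ) + 1) ^ 2 * ((k₂ : ℝ) + 1) ^ 2 + ((k₁ : ℝ) + 1) ^ 2 * ((k₃ : ℝ) + 1) ^ 2
            + ((k₂ : ℝ) + 1) ^ 2 * ((k₃ : ℝ) + 1) ^ 2) * S₂ (w i)
        - ((k₁ : ℝ) + 1) ^ 2 * ((k₂ : ℝ) + 1) ^ 2 * ((k₃ : ℝ) + 1) ^ 2 * S₀ (w i) = 0))
    (x : Fin (z + 7) → ℝ) (hx : StrictMono x) (hxI : ∀ i, x i ∈ Ioo u v) (hz : ∀ i, S₀ (x i) = 0) : False := by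
  -- level 1: T = S₂ − λ₁²S₀ with tower T, T₁ = S₃ − λ₁²S₁, T₂ = S₄ − λ₁²S₂, …
  set a : ℝ := ((k₁ : ℝ) + 1) ^ 2 with ha
  set b : ℝ := ((k₂ : ℝ) + 1) ^ 2 with hb
  set c : ℝ := ((k₃ : ℝ) + 1) ^ 2 with hc
  have hpos : ∀ x ∈ Ioo u v, (x : ℝ) ≠ 0 := fun x hx => (hu.trans_lt hx.1).ne'
  -- generic linear-combination derivative helper
  have lin : ∀ {F F₁ G G₁ : ℝ → ℝ} (μ : ℝ), (∀ x ∈ Ioo u v, HasDerivAt F (F₁ x / x) x) → (∀ x ∈ Ioo u v, HasDerivAt G (G₁ x / x) x) →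
      ∀ x ∈ Ioo u v, HasDerivAt (fun t => F t - μ * G t) ((F₁ x - μ * G₁ x) / x) x := by
    intro F F₁ G G₁ μ hF hG x hx
    have h := (hF x hx).sub ((hG x hx).const_mul μ)
    refine h.congr_deriv ?_
    field_simp
  obtain ⟨y, hy, hyI, hTy, -, -⟩ := theta_sq_chain k₁ hu h0 h1 (m := z + 4) x hx hxI hz
  -- y : Fin 5 → ℝ zeros of T := S₂ − a S₀
  have hT0 : ∀ x ∈ Ioo u v, HasDerivAt (fun t => S₂ t - a * S₀ t) ((S₃ x - a * S₁ x) / x) x := lin a h2 h0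
  have hT1 : ∀ x ∈ Ioo u v, HasDerivAt (fun t => S₃ t - a * S₁ t) ((S₄ x - a * S₂ x) / x) x := lin a h3 h1
  obtain ⟨ζ, hζ, hζI, hUζ, -, -⟩ := theta_sq_chain k₂ hu hT0 hT1 (m := z + 2) y hy hyI (fun i => by simpa [ha] using hTy i)
  -- ζ : Fin (z+3) → ℝ zeros of U := (S₄ − aS₂) − b(S₂ − aS₀)
  have hU0 : ∀ x ∈ Ioo u v, HasDerivAt (fun t => (S₄ t - a * S₂ t) - b * (S₂ t - a * S₀ t))
      (((S₅ x - a * S₃ x) - b * (S₃ x - a * S₁ x)) / x) x := lin b (lin a h4 h2) (lin a h2 h0)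
  have hU1 : ∀ x ∈ Ioo u v, HasDerivAt (fun t => (S₅ t - a * S₃ t) - b * (S₃ t - a * S₁ t))
      (((S₆ x - a * S₄ x) - b * (S₄ x - a * S₂ x)) / x) x := lin b (lin a h5 h3) (lin a h3 h1)
  obtain ⟨w, hw', hwI, hVw, -, -⟩ := theta_sq_chain k₃ hu hU0 hU1 (m := z) ζ hζ hζI (fun i => by simpa [hb] using hUζ i)
  refine hlaw w hw' hwI (fun i => ?_)
  have hw := hVw i
  -- the level-3 value is exactly L₃S
  have key : ((S₆ (w i) - a * S₄ (w i)) - b * (S₄ (w i) - a * S₂ (w i))) - c * ((S₄ (w i) - a * S₂ (w i)) - b * (S₂ (w i) - a * S₀ (w i)))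
      = S₆ (w i) - (a + b + c) * S₄ (w i) + (a * b + a * c + b * c) * S₂ (w i) - a * b * c * S₀ (w i) := by ring
  rw [← hc] at hw
  rw [ha, hb, hc] at key hw
  linarith [hw, key]

/-- ★ **SHELL-σ (order eight, real rates)**: if the order-8 law `Λ₄S` (roots `c₁², c₂², c₃², c₄²`) has NO strictly increasing chain of `z+1`
zeros in the window, then `S₀` has no strictly increasing chain of `z+9` zeros there (`z = 0` is ✓ `no_nine_zeros_of_eighth_order_law`).
[this file's theorem] -/
theorem no_chain_of_eighth_order_law_defects (c₁ c₂ c₃ c₄ : ℝ) (z : ℕ) {S₀ S₁ S₂ S₃ S₄ S₅ S₆ S₇ S₈ : ℝ → ℝ} {u v : ℝ} (hu : 0 ≤ u)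
    (h0 : ∀ x ∈ Ioo u v, HasDerivAt S₀ (S₁ x / x) x) (h1 : ∀ x ∈ Ioo u v, HasDerivAt S₁ (S₂ x / x) x)
    (h2 : ∀ x ∈ Ioo u v, HasDerivAt S₂ (S₃ x / x) x) (h3 : ∀ x ∈ Ioo u v, HasDerivAt S₃ (S₄ x / x) x)
    (h4 : ∀ x ∈ Ioo u v, HasDerivAt S₄ (S₅ x / x) x) (h5 : ∀ x ∈ Ioo u v, HasDerivAt S₅ (S₆ x / x) x)
    (h6 : ∀ x ∈ Ioo u v, HasDerivAt S₆ (S₇ x / x) x) (h7 : ∀ x ∈ Ioo u v, HasDerivAt S₇ (S₈ x / x) x)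
    (hlaw : ∀ w : Fin (z + 1) → ℝ, StrictMono w → (∀ i, w i ∈ Ioo u v) →
      ¬ (∀ i,
      S₈ (w i) - (c₁ ^ 2 + c₂ ^ 2 + c₃ ^ 2 + c₄ ^ 2) * S₆ (w i)
        + (c₁ ^ 2 * c₂ ^ 2 + c₁ ^ 2 * c₃ ^ 2 + c₁ ^ 2 * c₄ ^ 2 + c₂ ^ 2 * c₃ ^ 2 + c₂ ^ 2 * c₄ ^ 2 + c₃ ^ 2 * c₄ ^ 2) * S₄ (w i)
        - (c₁ ^ 2 * c₂ ^ 2 * c₃ ^ 2 + c₁ ^ 2 * c₂ ^ 2 * c₄ ^ 2 + c₁ ^ 2 * c₃ ^ 2 * c₄ ^ 2 + c₂ ^ 2 * c₃ ^ 2 * c₄ ^ 2) * S₂ (w i)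
        + c₁ ^ 2 * c₂ ^ 2 * c₃ ^ 2 * c₄ ^ 2 * S₀ (w i) = 0))
    (x : Fin (z + 9) → ℝ) (hx : StrictMono x) (hxI : ∀ i, x i ∈ Ioo u v) (hz : ∀ i, S₀ (x i) = 0) : False := by
  set p : ℝ := c₁ ^ 2 with hp
  set q : ℝ := c₂ ^ 2 with hq
  set r : ℝ := c₃ ^ 2 with hr
  set s : ℝ := c₄ ^ 2 with hs
  have lin : ∀ {F F₁ G G₁ : ℝ → ℝ} (μ : ℝ), (∀ x ∈ Ioo u v, HasDerivAt F (F₁ x / x) x) → (∀ x ∈ Ioo u v, HasDerivAt G (G₁ x / x) x) →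
      ∀ x ∈ Ioo u v, HasDerivAt (fun t => F t - μ * G t) ((F₁ x - μ * G₁ x) / x) x := by
    intro F F₁ G G₁ μ hF hG x hx
    have h := (hF x hx).sub ((hG x hx).const_mul μ)
    refine h.congr_deriv ?_
    field_simp
  -- level 1: factor c₁
  obtain ⟨y, hy, hyI, hTy, -, -⟩ := theta_sq_chain_real c₁ hu h0 h1 (m := z + 6) x hx hxI hz
  have hT0 := lin p h2 h0
  have hT1 := lin p h3 h1
  have hT2 := lin p h4 h2
  have hT3 := lin p h5 h3
  obtain ⟨ζ, hζ, hζI, hUζ, -, -⟩ := theta_sq_chain_real c₂ hu hT0 hT1 (m := z + 4) y hy hyI (fun i => by simpa [hp] using hTy i)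
  -- level 2 tower: U = (S₂ − pS₀) tower minus q·
  have hU0 := lin q hT2 hT0
  have hU1 := lin q hT3 hT1
  have hU2 := lin q (lin p h6 h4) hT2
  have hU3 := lin q (lin p h7 h5) hT3
  obtain ⟨w, hw', hwI, hVw, -, -⟩ := theta_sq_chain_real c₃ hu hU0 hU1 (m := z + 2) ζ hζ hζI (fun i => by simpa [hq] using hUζ i)
  have hV0 := lin r hU2 hU0
  have hV1 := lin r hU3 hU1
  obtain ⟨ω, hω, hωI, hWω, -, -⟩ := theta_sq_chain_real c₄ hu hV0 hV1 (m := z) w hw' hwI (fun i => by simpa [hr] using hVw i)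
  refine hlaw ω hω hωI (fun i => ?_)
  have hfin := hWω i
  rw [← hs] at hfin
  have key : (((S₈ (ω i) - p * S₆ (ω i)) - q * (S₆ (ω i) - p * S₄ (ω i))) - r * ((S₆ (ω i) - p * S₄ (ω i)) - q * (S₄ (ω i) - p * S₂ (ω i))))
      - s * (((S₆ (ω i) - p * S₄ (ω i)) - q * (S₄ (ω i) - p * S₂ (ω i))) - r * ((S₄ (ω i) - p * S₂ (ω i)) - q * (S₂ (ω i) - p * S₀ (ω i))))
      = S₈ (ω i) - (p + q + r + s) * S₆ (ω i) + (p * q + p * r + p * s + q * r + q * s + r * s) * S₄ (ω i)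
        - (p * q * r + p * q * s + p * r * s + q * r * s) * S₂ (ω i) + p * q * r * s * S₀ (ω i) := by ring
  rw [hp, hq, hr, hs] at key hfin
  linarith [hfin, key]

end ProductPlusOne

end Summit.ValiantsHypothesis.ValiantsHypothesis.Theorems.LacunarySymmetroidMatrixDescartes
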